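import Summits.QuantumFields.QCD.Theses.PauliWegnerSea
import Literature.MathematicalPhysics.QuantumLattice.OverlapLocality
import Literature.MathematicalPhysics.QuantumLattice.GaugeGroups
import Literature.MathematicalPhysics.QuantumFieldTheory.QCDPhaseQuenched
import Literature.MathematicalPhysics.QuantumFieldTheory.StrongCouplingActivities
import Literature.Analysis.Approximation.FiniteFamilyNikolskii
import Summits.QuantumFields.QCD.Theorems.PauliWegnerSeaFibreCofactorDominationNikolskiiPrep

/-!
# Stub `stub_nikolskii` of crux `FibreCofactorDomination` (stmt-QuantumFields-11510)

Line `Sketch-ideator3` (card A `random-refit-second-moment`), route PauliWegnerSea (sub QCD).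
Two-star Nikolskii inequality for the `(x,y)` adjugate block of the `r = 1` Wilson–Dirac matrix
under product Haar on the links: sup over the fibre of the sum of squared moduli of the block is
at most an absolute constant times its Haar mean.  Route (wave-1 worker): one-link polynomial
structure of the cofactors (`adjugate_wilsonDirac_update_mem`, landed in `…NikolskiiPrep`),
the abstract finite-family Nikolskii inequality
(`Literature.Analysis.Approximation.nikolskii_finite_family`) on a span of bounded products of
matrix entries of ONE link (`nikolskii_span_pow`), and peeling the `≤ 16` star links one at a
time (`pi_nikolskii` / `twoStar_nikolskii_of_oneLink`).
-/

noncomputable section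

namespace Summit.QuantumFields.QCD.Theorems.RandomRefit

open scoped BigOperators Matrix
open MeasureTheory Filter Literature.MathematicalPhysics.QuantumFieldTheory
  Literature.MathematicalPhysics.QuantumLattice Literature.Probability.LatticeModels
  Literature.Analysis.Approximation

variable {L : ℕ}

/-! ### One-link Nikolskii inequality on a span of bounded products -/

/-- **Nikolskii inequality on a span of bounded products** (`lintegral` form).  For finitely many
continuous generators `gen j : Ω → ℂ` with `‖gen j‖ ≤ 1` on a space with a finite measure of
full support, there is `C ≥ 1` such that every `f` in the submodule power `(span (range gen)) ^ n`
of the function algebra is continuous and satisfies `‖f ω‖² ≤ C ∫ ‖f‖² dμ` for every `ω`. -/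
theorem nikolskii_span_pow {Ω : Type*} [TopologicalSpace Ω] [MeasurableSpace Ω]
    [OpensMeasurableSpace Ω] (μ : Measure Ω) [IsFiniteMeasure μ]
    [μ.IsOpenPosMeasure] {J : Type*} [Fintype J] (gen : J → Ω → ℂ)
    (hgc : ∀ j, Continuous (gen j)) (hgb : ∀ j ω, ‖gen j ω‖ ≤ 1) (n : ℕ) :
    ∃ C : NNReal, 1 ≤ C ∧ ∀ f ∈ Submodule.span ℂ (Set.range gen) ^ n, Continuous f ∧
      ∀ ω, ENNReal.ofReal (‖f ω‖ ^ 2) ≤ C * ∫⁻ ω', ENNReal.ofReal (‖f ω'‖ ^ 2) ∂μ := by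
  classical
  set ψ : (Fin n → J) → Ω → ℂ := fun t => ∏ i, gen (t i) with hψ
  have hψc : ∀ t, Continuous (ψ t) := fun t => by
    have : ψ t = fun ω => ∏ i, gen (t i) ω := by ext ω; simp [hψ, Finset.prod_apply]
    rw [this]
    exact continuous_finsetProd _ fun i _ => hgc (t i)
  have hψb : ∀ t ω, ‖ψ t ω‖ ≤ 1 := fun t ω => by
    simp only [hψ, Finset.prod_apply, norm_prod]
    exact Finset.prod_le_one (fun _ _ => norm_nonneg _) fun i _ => hgb _ _
  obtain ⟨C₀, hC₀, hN⟩ := nikolskii_finite_family μ ψ hψc hψb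
  refine ⟨(max 1 C₀).toNNReal, ?_, fun f hf => ?_⟩
  · rw [← NNReal.coe_le_coe, NNReal.coe_one, Real.coe_toNNReal _ (by positivity)]
    exact le_max_left _ _
  obtain ⟨c, hc⟩ := (Submodule.mem_span_range_iff_exists_fun ℂ).mp
    (span_pow_le_span_prod gen n hf)
  have hf_eq : f = fun ω => ∑ k, c k * ψ k ω := by
    rw [← hc]; ext ω; simp [hψ, Finset.sum_apply, Finset.prod_apply]
  have hfc : Continuous f := by
    rw [hf_eq]; exact continuous_finsetSum _ fun k _ => continuous_const.mul (hψc k)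
  refine ⟨hfc, fun ω => ?_⟩
  have h1 : ‖f ω‖ ^ 2 ≤ C₀ * ∫ ω', ‖f ω'‖ ^ 2 ∂μ := by
    have := hN c ω
    simpa only [hf_eq] using this
  have hint : Integrable (fun ω' => ‖f ω'‖ ^ 2) μ :=
    (integrable_const ((∑ k, ‖c k‖) ^ 2)).mono' (hfc.norm.pow 2).aestronglyMeasurable
      (ae_of_all _ fun ω' => by
        rw [Real.norm_eq_abs, abs_of_nonneg (by positivity), hf_eq]
        exact pow_le_pow_left₀ (norm_nonneg _) (norm_eval_family_le ψ hψb c ω') 2)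
  have hI : 0 ≤ ∫ ω', ‖f ω'‖ ^ 2 ∂μ := integral_nonneg fun _ => by positivity
  calc ENNReal.ofReal (‖f ω‖ ^ 2) ≤ ENNReal.ofReal (max 1 C₀ * ∫ ω', ‖f ω'‖ ^ 2 ∂μ) :=
        ENNReal.ofReal_le_ofReal (h1.trans (mul_le_mul_of_nonneg_right (le_max_right _ _) hI))
    _ = ENNReal.ofReal (max 1 C₀) * ENNReal.ofReal (∫ ω', ‖f ω'‖ ^ 2 ∂μ) :=
        ENNReal.ofReal_mul (by positivity)
    _ = ((max 1 C₀).toNNReal : ENNReal) * ∫⁻ ω', ENNReal.ofReal (‖f ω'‖ ^ 2) ∂μ := by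
        rw [ofReal_integral_eq_lintegral_ofReal hint (ae_of_all _ fun _ => by positivity)]
        rfl

/-! ### Two-star Nikolskii from the one-link inequality -/

/-- **Two-star Nikolskii inequality, abstract refit form.**  If the one-link Nikolskii inequality holds
with constant `C ≥ 1` on `P ^ n` (`P ∋ 1, g_{ab}, conj g_{ab}`, `n ≥ 24`), then for every refit map
reading only the `≤ 16` links of `S`, the sum of squared moduli of the `(x,y)` adjugate block of
`D_W(refit W₀)` is at most `C ^ 16` times its product-Haar mean. -/
theorem twoStar_nikolskii_of_oneLink [NeZero L] (P : Submodule ℂ (SU3 → ℂ)) (h1 : (1 : SU3 → ℂ) ∈ P)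
    (hc : ∀ a b : Fin 3, (fun g : SU3 => (g : Matrix (Fin 3) (Fin 3) ℂ) a b) ∈ P)
    (hs : ∀ a b : Fin 3, (fun g : SU3 => star ((g : Matrix (Fin 3) (Fin 3) ℂ) a b)) ∈ P)
    (n : ℕ) (hn : 24 ≤ n) (C : NNReal) (h1C : 1 ≤ C)
    (hC : ∀ f ∈ P ^ n, Continuous f ∧ ∀ g₀ : SU3, ENNReal.ofReal (‖f g₀‖ ^ 2) ≤
      C * ∫⁻ g, ENNReal.ofReal (‖f g‖ ^ 2) ∂(haarProbability SU3))
    (m₀ r₀ : ℝ) (x y : TorusSite 4 L) (refit : GaugeConfig 4 L SU3 → GaugeConfig 4 L SU3)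
    (hrefit : Continuous refit) (S : Finset (Edge 4 L)) (hcard : S.card ≤ 16)
    (hS : ∀ e ∈ S, ∀ (W : GaugeConfig 4 L SU3) (g : SU3),
      refit (Function.update W e g) = Function.update (refit W) e g)
    (hnS : ∀ e ∉ S, ∀ (W : GaugeConfig 4 L SU3) (g : SU3), refit (Function.update W e g) = refit W)
    (W₀ : GaugeConfig 4 L SU3) :
    (∑ a : Fin 3, ∑ i : Fin 4, ∑ b : Fin 3, ∑ j : Fin 4,
        ‖(wilsonDirac (fundamentalRep (Fin 3)) (refit W₀) m₀ r₀).adjugate (x, a, i) (y, b, j)‖ ^ 2) ≤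
      (C : ℝ) ^ 16 * ∫ W, (∑ a : Fin 3, ∑ i : Fin 4, ∑ b : Fin 3, ∑ j : Fin 4,
        ‖(wilsonDirac (fundamentalRep (Fin 3)) (refit W) m₀ r₀).adjugate (x, a, i) (y, b, j)‖ ^ 2)
        ∂(Measure.pi fun _ : Edge 4 L => haarProbability SU3) := by
  classical
  set ν : Measure SU3 := haarProbability SU3 with hν
  set Φ : GaugeConfig 4 L SU3 → ENNReal := fun W => ENNReal.ofReal (∑ a : Fin 3, ∑ i : Fin 4,
      ∑ b : Fin 3, ∑ j : Fin 4, ‖(wilsonDirac (fundamentalRep (Fin 3)) (refit W) m₀ r₀).adjugate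
        (x, a, i) (y, b, j)‖ ^ 2) with hΦ
  -- continuity of the block sum
  have hQc : Continuous fun V : GaugeConfig 4 L SU3 => ∑ a : Fin 3, ∑ i : Fin 4, ∑ b : Fin 3,
      ∑ j : Fin 4, ‖(wilsonDirac (fundamentalRep (Fin 3)) V m₀ r₀).adjugate (x, a, i) (y, b, j)‖ ^ 2 := by
    have hD := (continuous_wilsonDirac (L := L) (fundamentalRep (Fin 3))
      (continuous_fundamentalRep (Fin 3)) m₀ r₀).matrix_adjugate
    exact continuous_finsetSum _ fun a _ => continuous_finsetSum _ fun i _ =>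
      continuous_finsetSum _ fun b _ => continuous_finsetSum _ fun j _ =>
        ((hD.matrix_elem _ _).norm.pow 2)
  have hΦm : Measurable Φ := ((hQc.comp hrefit).measurable).ennreal_ofReal
  -- the one-link inequality for the block sum
  have hlink : ∀ (V : GaugeConfig 4 L SU3) (e : Edge 4 L) (g₀ : SU3),
      ENNReal.ofReal (∑ a : Fin 3, ∑ i : Fin 4, ∑ b : Fin 3, ∑ j : Fin 4,
        ‖(wilsonDirac (fundamentalRep (Fin 3)) (Function.update V e g₀) m₀ r₀).adjugate
          (x, a, i) (y, b, j)‖ ^ 2) ≤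
      C * ∫⁻ g, ENNReal.ofReal (∑ a : Fin 3, ∑ i : Fin 4, ∑ b : Fin 3, ∑ j : Fin 4,
        ‖(wilsonDirac (fundamentalRep (Fin 3)) (Function.update V e g) m₀ r₀).adjugate
          (x, a, i) (y, b, j)‖ ^ 2) ∂ν := by
    intro V e g₀
    have h := ofReal_sum_sq_le ν C (fun k : Fin 3 × Fin 4 × Fin 3 × Fin 4 => fun g : SU3 =>
      (wilsonDirac (fundamentalRep (Fin 3)) (Function.update V e g) m₀ r₀).adjugate
        (x, k.1, k.2.1) (y, k.2.2.1, k.2.2.2))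
      (fun k => hC _ (adjugate_wilsonDirac_update_mem P h1 hc hs V e m₀ r₀ _ _ n hn)) g₀
    simpa only [Fintype.sum_prod_type] using h
  have hSΦ : ∀ e ∈ S, ∀ W, Φ W ≤ C * ∫⁻ g, Φ (Function.update W e g) ∂ν := by
    intro e he W
    have h := hlink (refit W) e (refit W e)
    rw [Function.update_eq_self] at h
    simpa only [hΦ, hS e he] using h
  have hnSΦ : ∀ e ∉ S, ∀ W g, Φ (Function.update W e g) = Φ W := by
    intro e he W g
    simp only [hΦ, hnS e he]
  -- peel the links
  have hmain := pi_nikolskii ν Φ hΦm S (C : ENNReal) ENNReal.coe_ne_top hSΦ hnSΦ W₀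
  have hC16 : (C : ENNReal) ^ S.card ≤ (C : ENNReal) ^ 16 :=
    pow_le_pow_right₀ (by exact_mod_cast h1C) hcard
  -- back to the Bochner integral
  have hint : Integrable (fun W => ∑ a : Fin 3, ∑ i : Fin 4, ∑ b : Fin 3, ∑ j : Fin 4,
      ‖(wilsonDirac (fundamentalRep (Fin 3)) (refit W) m₀ r₀).adjugate (x, a, i) (y, b, j)‖ ^ 2)
      (Measure.pi fun _ : Edge 4 L => ν) :=
    (hQc.comp hrefit).integrable_of_hasCompactSupport (HasCompactSupport.of_compactSpace _)
  have hI0 : 0 ≤ ∫ W, (∑ a : Fin 3, ∑ i : Fin 4, ∑ b : Fin 3, ∑ j : Fin 4,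
      ‖(wilsonDirac (fundamentalRep (Fin 3)) (refit W) m₀ r₀).adjugate (x, a, i) (y, b, j)‖ ^ 2)
      ∂(Measure.pi fun _ : Edge 4 L => ν) := integral_nonneg fun _ => by positivity
  have hlin : ∫⁻ W, Φ W ∂(Measure.pi fun _ : Edge 4 L => ν) =
      ENNReal.ofReal (∫ W, (∑ a : Fin 3, ∑ i : Fin 4, ∑ b : Fin 3, ∑ j : Fin 4,
        ‖(wilsonDirac (fundamentalRep (Fin 3)) (refit W) m₀ r₀).adjugate (x, a, i) (y, b, j)‖ ^ 2)
        ∂(Measure.pi fun _ : Edge 4 L => ν)) := by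
    rw [ofReal_integral_eq_lintegral_ofReal hint (ae_of_all _ fun _ => by positivity)]
  have hfin : Φ W₀ ≤ ENNReal.ofReal ((C : ℝ) ^ 16 * ∫ W, (∑ a : Fin 3, ∑ i : Fin 4, ∑ b : Fin 3,
      ∑ j : Fin 4, ‖(wilsonDirac (fundamentalRep (Fin 3)) (refit W) m₀ r₀).adjugate
        (x, a, i) (y, b, j)‖ ^ 2) ∂(Measure.pi fun _ : Edge 4 L => ν)) := by
    calc Φ W₀ ≤ (C : ENNReal) ^ S.card * ∫⁻ W, Φ W ∂(Measure.pi fun _ : Edge 4 L => ν) := hmain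
      _ ≤ (C : ENNReal) ^ 16 * ∫⁻ W, Φ W ∂(Measure.pi fun _ : Edge 4 L => ν) :=
          mul_le_mul' hC16 le_rfl
      _ = _ := by
          rw [hlin, ENNReal.ofReal_mul (by positivity), ENNReal.ofReal_pow NNReal.zero_le_coe,
            ENNReal.ofReal_coe_nnreal]
  exact (ENNReal.ofReal_le_ofReal_iff (mul_nonneg (by positivity) hI0)).mp hfin

/-- Two-star Nikolskii inequality: the sum of squared moduli of the 144 entries of the `(x,y)` adjugate block of `D_W(refit W)` at any fibre point `W₀` is at most `C_N` times its mean under product Haar, with `C_N` absolute (the functions range in a fixed finite-dimensional space of polynomials of the ≤ 16 star links). -/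
theorem stub_nikolskii : ∃ CN : ℝ, 0 < CN ∧ ∀ (m₀ : ℝ), -2 ≤ m₀ → m₀ ≤ 2 → ∀ (L : ℕ) [NeZero L],
    4 ≤ L → ∀ (U : GaugeConfig 4 L (Matrix.specialUnitaryGroup (Fin 3) ℂ)) (x y : TorusSite 4 L)
    (W₀ : GaugeConfig 4 L (Matrix.specialUnitaryGroup (Fin 3) ℂ)),
    (∑ a : Fin 3, ∑ i : Fin 4, ∑ b : Fin 3, ∑ j : Fin 4,
        ‖(wilsonDirac (fundamentalRep (Fin 3)) (fun e => if e.1 = x ∨ Site.shift e.1 e.2 = x ∨ e.1 = y ∨ Site.shift e.1 e.2 = y then W₀ e else U e) m₀ 1).adjugate (x, a, i) (y, b, j)‖ ^ 2) ≤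
      CN * ∫ W, (∑ a : Fin 3, ∑ i : Fin 4, ∑ b : Fin 3, ∑ j : Fin 4,
        ‖(wilsonDirac (fundamentalRep (Fin 3)) (fun e => if e.1 = x ∨ Site.shift e.1 e.2 = x ∨ e.1 = y ∨ Site.shift e.1 e.2 = y then W e else U e) m₀ 1).adjugate (x, a, i) (y, b, j)‖ ^ 2)
        ∂(Measure.pi fun _ : Edge 4 L => haarProbability (Matrix.specialUnitaryGroup (Fin 3) ℂ)) := by
  classical
  -- the generators `1`, `g_{ab}`, `conj g_{ab}` of the one-link space and its Nikolskii constant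
  set gen : Unit ⊕ (Fin 3 × Fin 3) ⊕ (Fin 3 × Fin 3) → SU3 → ℂ :=
    Sum.elim (fun _ _ => (1 : ℂ)) (Sum.elim (fun ab g => (g : Matrix (Fin 3) (Fin 3) ℂ) ab.1 ab.2)
      (fun ab g => star ((g : Matrix (Fin 3) (Fin 3) ℂ) ab.1 ab.2))) with hgen
  have hgc : ∀ j, Continuous (gen j) := by
    rintro (_ | ⟨a, b⟩ | ⟨a, b⟩) <;> simp only [hgen, Sum.elim_inl, Sum.elim_inr]
    · exact continuous_const
    · exact continuous_subtype_val.matrix_elem a b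
    · exact (continuous_subtype_val.matrix_elem a b).star
  have hgb : ∀ j g, ‖gen j g‖ ≤ 1 := by
    rintro (_ | ⟨a, b⟩ | ⟨a, b⟩) g <;> simp only [hgen, Sum.elim_inl, Sum.elim_inr]
    · simp
    · exact entry_norm_bound_of_unitary g.2.1 a b
    · rw [norm_star]; exact entry_norm_bound_of_unitary g.2.1 a b
  obtain ⟨C, h1C, hC⟩ := nikolskii_span_pow (haarProbability SU3) gen hgc hgb 24
  have hP1 : (1 : SU3 → ℂ) ∈ Submodule.span ℂ (Set.range gen) :=
    Submodule.subset_span ⟨Sum.inl (), by rw [hgen]; rfl⟩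
  have hPc : ∀ a b : Fin 3, (fun g : SU3 => (g : Matrix (Fin 3) (Fin 3) ℂ) a b) ∈
      Submodule.span ℂ (Set.range gen) := fun a b =>
    Submodule.subset_span ⟨Sum.inr (Sum.inl (a, b)), by rw [hgen]; rfl⟩
  have hPs : ∀ a b : Fin 3, (fun g : SU3 => star ((g : Matrix (Fin 3) (Fin 3) ℂ) a b)) ∈
      Submodule.span ℂ (Set.range gen) := fun a b =>
    Submodule.subset_span ⟨Sum.inr (Sum.inr (a, b)), by rw [hgen]; rfl⟩
  refine ⟨(C : ℝ) ^ 16, by positivity, fun m₀ _ _ L _ _ U x y W₀ => ?_⟩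
  have hS : ∀ e ∈ (Finset.univ.filter fun e : Edge 4 L =>
      e.1 = x ∨ e.1.shift e.2 = x ∨ e.1 = y ∨ e.1.shift e.2 = y),
      ∀ (W : GaugeConfig 4 L SU3) (g : SU3),
        (fun e' => if e'.1 = x ∨ e'.1.shift e'.2 = x ∨ e'.1 = y ∨ e'.1.shift e'.2 = y then
            Function.update W e g e' else U e') =
          Function.update (fun e' => if e'.1 = x ∨ e'.1.shift e'.2 = x ∨ e'.1 = y ∨
            e'.1.shift e'.2 = y then W e' else U e') e g := fun e he W g =>
    refit_update_of_mem (fun e' : Edge 4 L => e'.1 = x ∨ e'.1.shift e'.2 = x ∨ e'.1 = y ∨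
      e'.1.shift e'.2 = y) U W e g (Finset.mem_filter.mp he).2
  have hnS : ∀ e ∉ (Finset.univ.filter fun e : Edge 4 L =>
      e.1 = x ∨ e.1.shift e.2 = x ∨ e.1 = y ∨ e.1.shift e.2 = y),
      ∀ (W : GaugeConfig 4 L SU3) (g : SU3),
        (fun e' => if e'.1 = x ∨ e'.1.shift e'.2 = x ∨ e'.1 = y ∨ e'.1.shift e'.2 = y then
            Function.update W e g e' else U e') =
          fun e' => if e'.1 = x ∨ e'.1.shift e'.2 = x ∨ e'.1 = y ∨ e'.1.shift e'.2 = y then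
            W e' else U e' := fun e he W g =>
    refit_update_of_not_mem (fun e' : Edge 4 L => e'.1 = x ∨ e'.1.shift e'.2 = x ∨ e'.1 = y ∨
      e'.1.shift e'.2 = y) U W e g (by simpa only [Finset.mem_filter, Finset.mem_univ, true_and] using he)
  exact twoStar_nikolskii_of_oneLink (Submodule.span ℂ (Set.range gen)) hP1 hPc hPs 24 le_rfl C h1C hC
    m₀ 1
    x y (fun W e' => if e'.1 = x ∨ e'.1.shift e'.2 = x ∨ e'.1 = y ∨ e'.1.shift e'.2 = y then W e'
      else U e')
    (continuous_refit (fun e' : Edge 4 L => e'.1 = x ∨ e'.1.shift e'.2 = x ∨ e'.1 = y ∨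
      e'.1.shift e'.2 = y) U) _ (card_twoStar_le x y) hS hnS W₀

end Summit.QuantumFields.QCD.Theorems.RandomRefit

end
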